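import Summits.HodgeConjecture.HodgeConjecture.Theorems.H413RallisTransportConsumption
import Summits.HodgeConjecture.HodgeConjecture.Theorems.H413ThetaDistNonvanishingOfLift
import Literature.NumberTheory.GelbartRogawski1991.UnitaryDualPairThetaLiftSplittingTwist
import HarnessLib

/-!
# FLOOR-0 P4, seat (δ) — THE `hne` BRIDGE: a non-zero theta lift of the unitary dual pair AT THE PIN'S SPLITTING gives a
# non-zero slot-0 theta DISTRIBUTION of the line's model datum

Cell hodgecm-mathlib (D-0151), FLOOR 0, crux item H413 = stmt-HodgeConjecture-24833; programme P4, line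
`Cruxes/H413/Lines/F0_P4AdmissibleOccursInH1.lean` ED. 2, stub S4b `stub_T3a_holThetaAtAdmissibleLineOfRallisAt`; PLAN-F0P4 v2 §3∕§5.3 and
F0P4-plan (g2) 2026-08-30T23:04:56Z (δ).  Author F0P4-p05 (g0).  `--supports stmt-HodgeConjecture-24833` (helper; DEF-FREE).
Namespace `Summit.HodgeConjecture.HodgeConjecture.Cruxes.H413.RallisTransport`.

THE TWO ENDS (by name).  CONSUMER: the capstone ★ `ThetaJunction.exists_holReal_of_transport(_sideAt)` (p793201) wants
`hne : ∃ Φ_f, D.dist (charInv χ̃) Φ_f ≠ 0` for the model's product theta-distribution datum `D : S.ThetaDistDatum hV 0` over a side `S` with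
`(S.P 0).ω = lineRepOf V Sw hGR hGR₀ … η₀ … 0` (★ `ThetaDistAtLine.sideAt`, `rfl`).  PRODUCER: ★ `thetaLift_charCM_tmul_ne_zero_of_finCoeff_ne_zero`
(p792361 ∕ p792893: S6 = [Li1992, Thm 2.1] + (A) + (FIN)) gives `Θ^{s}_{Φ_∞ ⊗ Φ_f}(charCM χ̃₂) ≠ 0` for the tree's unitary dual pair
`UnitaryDualPair.thetaKernelDatum … s hs hρ SK hSK` at the PIN's explicit compatible splitting `s = s_μ(a)`.  In between sit three ★ bridges:

1. ★ `ThetaNonvanishing.dist_ne_zero_of_thetaLift_toThetaTop_ne_zero` (p793852): `D.dist f Φ_f ≠ 0 ⟸ (S.P 0).kernelDatum.thetaLift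
   probHaar (toThetaTop (piSchwartzBruhatEquiv (D.Φarch ℓ ⊗ Φ_f))) f ≠ 0`;
2. ★ J-R `RallisTransport.kernelDatum_thetaLift_comp_mul_ne_zero_iff` (p794303): that model lift of `(f₂ ∘ a) · κ₁` is non-zero iff the lift of
   `cmThetaKernelDatum L e₁ (frameD V) … (lineVec (dW Sw 0)) … hGR₀ hρ₀ SK₀ hSK₀` — S6's datum at the ABSTRACT splitting `splittingOf hGR₀` — of `f₂`
   against `probHaar.map a` is (`a = cosetCongr (cmLineTorusEquiv …)`, `κ₁` the J-R multiplier `t ↦ η₀(1,t♭) · χ₀(1, t♭·1₁)`);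
3. ★ `UnitaryDualPair.thetaLift_mul_ne_zero_iff_of_twist_splitting` (p793899): `Θ^{s ⊗ ĉ}_Φ(f₃ · κ₂) ≠ 0 ↔ Θ^{s}_Φ(f₃) ≠ 0` for
   `splittingOf hGR₀ = s ⊗ ĉ` ([GelbartRogawski1991, §3.1 Remark]; `ĉ` from ★ `exists_eq_twist_of_isCompatible`, `κ₂([h]) = ĉ(1 ⊗ h)`).

THIS FILE composes them (kernel; the splitting equation enters by `subst` on a generalised `s₀`):

* **`dist_ne_zero_of_pin_thetaLift_ne_zero`** — for such `S`, `D`, the pin splitting `s` with `splittingOf hGR₀ = s ⊗ ĉ`, the two continuous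
  multipliers `κ₁` (on `[U(1)]`) and `κ₂` (on `[U(⟨a₀⟩)]`), every `ℓ`, `Φ_f`, `f₂`:
  `Θ^{s}_{D.Φarch ℓ ⊗ Φ_f}(f₂) ≠ 0` (lift against `probHaar.map a`) ⟹ **`D.dist (((f₂ · κ₂) ∘ a) · κ₁) Φ_f ≠ 0`**;
* **`exists_dist_ne_zero_of_pin_thetaLift_ne_zero`** — the `hne` row itself for `f := ((f₂ · κ₂) ∘ a) · κ₁`: `∃ Φ_f, D.dist f Φ_f ≠ 0`.

WHAT THE CONSUMER STILL SUPPLIES (other seats, by name): the producer's hypotheses `hR` (S6 at `μ := probHaar.map a` — its `μ`-binders ★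
`RallisTransport.smulInvariantMeasure_map_cosetCongr` ∕ `isOpenPosMeasure_map_cosetCongr'`, ★ `isOpenPosMeasure_probHaarRelNormOneQuot`), `heig` (A),
`hfin` (FIN), all IN THE GRAM SPELLING `UnitaryGroup.adelic L⁺ L conj 1 (Matrix.diagonal (lineVec (dW Sw 0)))` of the model; the multipliers
(★ `RallisTransport.exists_kappa`, ★ `UnitaryDualPair.exists_kappa_of_twist_splitting`); and the CHARACTER CONSISTENCY identifying the model's
test function `charInv χ̃` with `((charCM χ̃₂ · κ₂) ∘ a) · κ₁` (the (χ) bridge, F0P4-p02: ★ p793900 `exists_chiFin_eq_mul` is its constructor).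
HC_CM is proved only modulo the printed citations until rung 0 closes; this file proves nothing about them.

## References (conventions only; nothing of print is asserted)
* [Li1992] J.-S. Li, J. reine angew. Math. 428 (1992), Thm 2.1 (26) p. 184, p. 178.
* [GelbartRogawski1991] S. Gelbart, J. Rogawski, Invent. Math. 105 (1991), §3.1 Remark p. 457 L4–13.
* [Liu2021] Y. Liu, Camb. J. Math. 9 (2021) = arXiv:2102.11518, proof of Prop. 4.13 (l. 2145).
-/

set_option autoImplicit false
set_option linter.dupNamespace false

noncomputable section

open _root_.MeasureTheory
open NumberField hiding relNormOneIdeles relNormOneRat probHaarRelNormOneQuot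
open scoped Matrix TensorProduct
open Literature.NumberTheory.Automorphic Literature.NumberTheory.Automorphic.UnitaryGroup Literature.NumberTheory.Weil1964
open Literature.NumberTheory.Weil1964.ThetaKernelDatum
open Literature.NumberTheory.GelbartRogawski1991 Literature.NumberTheory.GelbartRogawski1991.UnitaryDualPair
open Literature.MeasureTheory.Group
open HodgeCM HodgeCM.Adelic HodgeCM.PerL34 HodgeCM.Model HodgeCM.Model.ArchSideTerm HodgeCM.Model.SupplyResidual HodgeCM.Model.ThetaAdelicSide
open Summit.HodgeConjecture.HodgeConjecture.Cruxes.H413.ThetaNonvanishing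

namespace Summit.HodgeConjecture.HodgeConjecture.Cruxes.H413.RallisTransport

variable {L : CMField} {ι₁ : L →+* ℂ} (V : HermSpace3 L ι₁) (hV : IsAnisotropic L V.Hm) (Sw : StubTree.SeesawDatum L)
variable
  (hGR : (cmSplittingDatum (L : Type) finProdFinEquiv (frameD V) (frameD_real V) (frameD_ne V) (dW Sw) (dW_real Sw) (dW_ne Sw)).CompatibleSplitting)
  (hGR₀ : (cmSplittingDatum (L : Type) (e₁) (frameD V) (frameD_real V) (frameD_ne V) (lineVec (L : Type) (dW Sw 0))
    (fun _ => dW_real Sw 0) (fun _ => dW_ne Sw 0)).CompatibleSplitting)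
  (hGR₁ : (cmSplittingDatum (L : Type) (e₁) (frameD V) (frameD_real V) (frameD_ne V) (lineVec (L : Type) (dW Sw 1))
    (fun _ => dW_real Sw 1) (fun _ => dW_ne Sw 1)).CompatibleSplitting)
  (hGR₂ : (cmSplittingDatum (L : Type) (e₁) (frameD V) (frameD_real V) (frameD_ne V) (lineVec (L : Type) (dW' Sw 0))
    (fun _ => dW'_real Sw 0) (fun _ => dW'_ne Sw 0)).CompatibleSplitting)
  (hGR₃ : (cmSplittingDatum (L : Type) (e₁) (frameD V) (frameD_real V) (frameD_ne V) (lineVec (L : Type) (dW' Sw 1))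
    (fun _ => dW'_real Sw 1) (fun _ => dW'_ne Sw 1)).CompatibleSplitting)
  (η₀ η₁ η₂ η₃ : CMAdelic (L : Type) (frameD V) × CMAdelicOne (L : Type) →* ℂˣ)
  -- the model side and its slot-0 product datum
  {c' : SeesawCtx L} (S : ThetaAdelicSide V c') (hSω : (S.P 0).ω = lineRepOf V Sw hGR hGR₀ hGR₁ hGR₂ hGR₃ η₀ η₁ η₂ η₃ 0)
  (D : S.ThetaDistDatum hV 0)
  -- S6's datum at the ABSTRACT splitting `splittingOf hGR₀` (its majorants and index set)
  (hρ₀ : HasThetaMajorants fun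
    (p : CMAdelic (L : Type) (frameD V) × CMAdelic (L : Type) (lineVec (L : Type) (dW Sw 0)))
    (Φ : piSchwartzBruhat (↥(maximalRealSubfield L)) (Fin 3)) =>
      cmPairRep (L : Type) e₁ (frameD V) (frameD_real V) (frameD_ne V) (lineVec (L : Type) (dW Sw 0))
        (fun _ => dW_real Sw 0) (fun _ => dW_ne Sw 0) hGR₀ p Φ)
  (SK₀ : Set (piSchwartzBruhat (↥(maximalRealSubfield L)) (Fin 3)))
  (hSK₀ : ∀ (h : CMAdelic (L : Type) (lineVec (L : Type) (dW Sw 0))) (Φ : piSchwartzBruhat (↥(maximalRealSubfield L)) (Fin 3)),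
    Φ ∈ SK₀ → cmPairRep (L : Type) e₁ (frameD V) (frameD_real V) (frameD_ne V) (lineVec (L : Type) (dW Sw 0))
      (fun _ => dW_real Sw 0) (fun _ => dW_ne Sw 0) hGR₀ (1, h) Φ ∈ SK₀)
  -- S6's datum at the PIN's explicit splitting `s`, with `splittingOf hGR₀ = s ⊗ ĉ`
  {s : ↥(UnitaryGroup.adelicPair (↥(maximalRealSubfield L)) (L : Type) (IsCMField.complexConj L) 3 1
      (Matrix.diagonal (frameD V)) (Matrix.diagonal (lineVec (L : Type) (dW Sw 0)))) →*
    adelicMpCont (↥(maximalRealSubfield L)) (Fin 3)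
      (adelicGram (↥(maximalRealSubfield L)) e₁ (realDiagonal (L : Type) (frameD V) (frameD_real V))
        (realDiagonal (L : Type) (lineVec (L : Type) (dW Sw 0)) fun _ => dW_real Sw 0))}
  (hs : (cmSplittingDatum (L : Type) e₁ (frameD V) (frameD_real V) (frameD_ne V) (lineVec (L : Type) (dW Sw 0))
    (fun _ => dW_real Sw 0) (fun _ => dW_ne Sw 0)).IsCompatible s)
  (ĉ : ↥(UnitaryGroup.adelicPair (↥(maximalRealSubfield L)) (L : Type) (IsCMField.complexConj L) 3 1
      (Matrix.diagonal (frameD V)) (Matrix.diagonal (lineVec (L : Type) (dW Sw 0)))) →* ℂˣ)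
  (heq : splittingOf (↥(maximalRealSubfield L)) (L : Type) (IsCMField.complexConj L) 3 1 e₁ (Matrix.diagonal (frameD V))
      (Matrix.diagonal (lineVec (L : Type) (dW Sw 0))) (complexConj_imagUnit (L : Type)) (imagUnit_ne_zero (L : Type))
      (imagUnit_mul_self (L : Type)) (realDiagonal_isSymm (L : Type) (frameD V) (frameD_real V))
      (realDiagonal_isSymm (L : Type) (lineVec (L : Type) (dW Sw 0)) fun _ => dW_real Sw 0)
      (isUnit_det_realDiagonal (L : Type) (frameD V) (frameD_real V) (frameD_ne V))
      (isUnit_det_realDiagonal (L : Type) (lineVec (L : Type) (dW Sw 0)) (fun _ => dW_real Sw 0) fun _ => dW_ne Sw 0)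
      (realDiagonal_map (L : Type) (frameD V) (frameD_real V)).symm
      (realDiagonal_map (L : Type) (lineVec (L : Type) (dW Sw 0)) fun _ => dW_real Sw 0).symm hGR₀ =
    adelicMpCont.twist (↥(maximalRealSubfield L)) (Fin 3) _ s ĉ)
  (hρ : HasThetaMajorants fun
    (p : CMAdelic (L : Type) (frameD V) × CMAdelic (L : Type) (lineVec (L : Type) (dW Sw 0)))
    (Φ : piSchwartzBruhat (↥(maximalRealSubfield L)) (Fin 3)) =>
      pairRep (↥(maximalRealSubfield L)) (L : Type) (IsCMField.complexConj L) 3 1 e₁ (Matrix.diagonal (frameD V))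
        (Matrix.diagonal (lineVec (L : Type) (dW Sw 0))) s p Φ)
  (SK : Set (piSchwartzBruhat (↥(maximalRealSubfield L)) (Fin 3)))
  (hSK : ∀ (h : CMAdelic (L : Type) (lineVec (L : Type) (dW Sw 0))) (Φ : piSchwartzBruhat (↥(maximalRealSubfield L)) (Fin 3)),
    Φ ∈ SK → pairRep (↥(maximalRealSubfield L)) (L : Type) (IsCMField.complexConj L) 3 1 e₁ (Matrix.diagonal (frameD V))
      (Matrix.diagonal (lineVec (L : Type) (dW Sw 0))) s (1, h) Φ ∈ SK)
  [MeasurableSpace (CMAdelic (L : Type) (lineVec (L : Type) (dW Sw 0)) ⧸ CMRat (L : Type) (lineVec (L : Type) (dW Sw 0)))]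
  [BorelSpace (CMAdelic (L : Type) (lineVec (L : Type) (dW Sw 0)) ⧸ CMRat (L : Type) (lineVec (L : Type) (dW Sw 0)))]
  [CompactSpace (CMAdelic (L : Type) (frameD V) ⧸ CMRat (L : Type) (frameD V))]
  [CompactSpace (CMAdelic (L : Type) (lineVec (L : Type) (dW Sw 0)) ⧸ CMRat (L : Type) (lineVec (L : Type) (dW Sw 0)))]

/-- shorthand-free restatement used twice below: S6's theta-kernel datum of the CM pair `(diag (frameD V), ⟨dW Sw 0⟩)` at a splitting `s₀`.
(A `private` abbreviation would be a `def`; we spell the term out instead.) -/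
private theorem thetaLift_mul_ne_zero_iff_of_eq_twist_aux
    (μ : Measure (CMAdelic (L : Type) (lineVec (L : Type) (dW Sw 0)) ⧸ CMRat (L : Type) (lineVec (L : Type) (dW Sw 0))))
    [IsFiniteMeasure μ]
    (s₀ : ↥(UnitaryGroup.adelicPair (↥(maximalRealSubfield L)) (L : Type) (IsCMField.complexConj L) 3 1
      (Matrix.diagonal (frameD V)) (Matrix.diagonal (lineVec (L : Type) (dW Sw 0)))) →*
      adelicMpCont (↥(maximalRealSubfield L)) (Fin 3)
        (adelicGram (↥(maximalRealSubfield L)) e₁ (realDiagonal (L : Type) (frameD V) (frameD_real V))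
          (realDiagonal (L : Type) (lineVec (L : Type) (dW Sw 0)) fun _ => dW_real Sw 0)))
    (hs₀ : (cmSplittingDatum (L : Type) e₁ (frameD V) (frameD_real V) (frameD_ne V) (lineVec (L : Type) (dW Sw 0))
      (fun _ => dW_real Sw 0) (fun _ => dW_ne Sw 0)).IsCompatible s₀)
    (hρ₀' : HasThetaMajorants fun
      (p : CMAdelic (L : Type) (frameD V) × CMAdelic (L : Type) (lineVec (L : Type) (dW Sw 0)))
      (Φ : piSchwartzBruhat (↥(maximalRealSubfield L)) (Fin 3)) =>
        pairRep (↥(maximalRealSubfield L)) (L : Type) (IsCMField.complexConj L) 3 1 e₁ (Matrix.diagonal (frameD V))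
          (Matrix.diagonal (lineVec (L : Type) (dW Sw 0))) s₀ p Φ)
    (SK₀' : Set (piSchwartzBruhat (↥(maximalRealSubfield L)) (Fin 3)))
    (hSK₀' : ∀ (h : CMAdelic (L : Type) (lineVec (L : Type) (dW Sw 0))) (Φ : piSchwartzBruhat (↥(maximalRealSubfield L)) (Fin 3)),
      Φ ∈ SK₀' → pairRep (↥(maximalRealSubfield L)) (L : Type) (IsCMField.complexConj L) 3 1 e₁ (Matrix.diagonal (frameD V))
        (Matrix.diagonal (lineVec (L : Type) (dW Sw 0))) s₀ (1, h) Φ ∈ SK₀')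
    (h0 : s₀ = adelicMpCont.twist (↥(maximalRealSubfield L)) (Fin 3) _ s ĉ)
    (κ₂ : C(CMAdelic (L : Type) (lineVec (L : Type) (dW Sw 0)) ⧸ CMRat (L : Type) (lineVec (L : Type) (dW Sw 0)), ℂ))
    (hκ₂ : ∀ h : CMAdelic (L : Type) (lineVec (L : Type) (dW Sw 0)),
      κ₂ (QuotientGroup.mk h) =
        ((ĉ (UnitaryGroup.adelicInr (↥(maximalRealSubfield L)) (L : Type) (IsCMField.complexConj L) 3 1
          (Matrix.diagonal (frameD V)) (Matrix.diagonal (lineVec (L : Type) (dW Sw 0))) h) : ℂˣ) : ℂ))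
    (Φ : piSchwartzBruhat (↥(maximalRealSubfield L)) (Fin 3))
    (f₃ : C(CMAdelic (L : Type) (lineVec (L : Type) (dW Sw 0)) ⧸ CMRat (L : Type) (lineVec (L : Type) (dW Sw 0)), ℂ)) :
    (thetaKernelDatum (↥(maximalRealSubfield L)) (L : Type) (IsCMField.complexConj L) 3 1 e₁ (Matrix.diagonal (frameD V))
          (Matrix.diagonal (lineVec (L : Type) (dW Sw 0))) (complexConj_imagUnit (L : Type)) (imagUnit_ne_zero (L : Type))
          (imagUnit_mul_self (L : Type)) (realDiagonal_isSymm (L : Type) (frameD V) (frameD_real V))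
          (realDiagonal_isSymm (L : Type) (lineVec (L : Type) (dW Sw 0)) fun _ => dW_real Sw 0)
          (isUnit_det_realDiagonal (L : Type) (frameD V) (frameD_real V) (frameD_ne V))
          (isUnit_det_realDiagonal (L : Type) (lineVec (L : Type) (dW Sw 0)) (fun _ => dW_real Sw 0) fun _ => dW_ne Sw 0)
          (realDiagonal_map (L : Type) (frameD V) (frameD_real V)).symm
          (realDiagonal_map (L : Type) (lineVec (L : Type) (dW Sw 0)) fun _ => dW_real Sw 0).symm s₀ hs₀ hρ₀' SK₀' hSK₀').thetaLift
        μ Φ (f₃ * κ₂) ≠ 0 ↔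
      (thetaKernelDatum (↥(maximalRealSubfield L)) (L : Type) (IsCMField.complexConj L) 3 1 e₁ (Matrix.diagonal (frameD V))
          (Matrix.diagonal (lineVec (L : Type) (dW Sw 0))) (complexConj_imagUnit (L : Type)) (imagUnit_ne_zero (L : Type))
          (imagUnit_mul_self (L : Type)) (realDiagonal_isSymm (L : Type) (frameD V) (frameD_real V))
          (realDiagonal_isSymm (L : Type) (lineVec (L : Type) (dW Sw 0)) fun _ => dW_real Sw 0)
          (isUnit_det_realDiagonal (L : Type) (frameD V) (frameD_real V) (frameD_ne V))
          (isUnit_det_realDiagonal (L : Type) (lineVec (L : Type) (dW Sw 0)) (fun _ => dW_real Sw 0) fun _ => dW_ne Sw 0)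
          (realDiagonal_map (L : Type) (frameD V) (frameD_real V)).symm
          (realDiagonal_map (L : Type) (lineVec (L : Type) (dW Sw 0)) fun _ => dW_real Sw 0).symm s hs hρ SK hSK).thetaLift
        μ Φ f₃ ≠ 0 := by
  subst h0
  exact thetaLift_mul_ne_zero_iff_of_twist_splitting (↥(maximalRealSubfield L)) (L : Type) (IsCMField.complexConj L) 3 1 e₁
    (Matrix.diagonal (frameD V)) (Matrix.diagonal (lineVec (L : Type) (dW Sw 0))) (complexConj_imagUnit (L : Type))
    (imagUnit_ne_zero (L : Type)) (imagUnit_mul_self (L : Type)) (realDiagonal_isSymm (L : Type) (frameD V) (frameD_real V))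
    (realDiagonal_isSymm (L : Type) (lineVec (L : Type) (dW Sw 0)) fun _ => dW_real Sw 0)
    (isUnit_det_realDiagonal (L : Type) (frameD V) (frameD_real V) (frameD_ne V))
    (isUnit_det_realDiagonal (L : Type) (lineVec (L : Type) (dW Sw 0)) (fun _ => dW_real Sw 0) fun _ => dW_ne Sw 0)
    (realDiagonal_map (L : Type) (frameD V) (frameD_real V)).symm
    (realDiagonal_map (L : Type) (lineVec (L : Type) (dW Sw 0)) fun _ => dW_real Sw 0).symm hs ĉ hs₀ hρ SK hSK hρ₀' SK₀' hSK₀'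
    μ κ₂ hκ₂ Φ f₃

include hSω heq hρ₀ SK₀ hSK₀ in
/-- **THE `hne` BRIDGE.**  If the theta lift of S6's unitary dual pair `(U(diag (frameD V)), U(⟨dW Sw 0⟩))` AT THE PIN'S SPLITTING `s`, of the
test vector `D.Φarch ℓ ⊗ Φ_f` (the line's harmonic archimedean vector times a finite test function) and of the test function `f₂`, against the
push-forward `probHaar.map a` of the probability Haar measure of `[U(1)]`, is NON-ZERO, then the line's slot-0 theta DISTRIBUTION of `Φ_f`
integrated against `((f₂ · κ₂) ∘ a) · κ₁` is non-zero — `κ₂` the splitting multiplier (`splittingOf hGR₀ = s ⊗ ĉ`), `κ₁` the J-R multiplier,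
`a = cosetCongr (cmLineTorusEquiv …)`.  (Composition of ★ brick 10, ★ J-R consumption form and ★ the splitting-twist transport.)
[cite: Li1992, p. 178; GelbartRogawski1991, §3.1 Remark p. 457 L4–13; Liu2021, proof of Prop. 4.13 (l. 2145)] -/
theorem dist_ne_zero_of_pin_thetaLift_ne_zero
    (κ₁ : C(↥(relNormOneIdeles (↥(maximalRealSubfield L)) L) ⧸ relNormOneRat (↥(maximalRealSubfield L)) L, ℂ))
    (hκ₁ : ∀ t : ↥(relNormOneIdeles (↥(maximalRealSubfield L)) L),
      κ₁ (QuotientGroup.mk t) =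
        ((η₀ (1, (cmAdelicOneEquivRelNormOne (L : Type)).symm t) *
            cmLineChar₀ (L : Type) finProdFinEquiv e₁ (frameD V) (frameD_real V) (frameD_ne V) (dW Sw) (dW_real Sw) (dW_ne Sw)
              hGR hGR₀ hGR₁ (1, cmLineTorusEquiv (L : Type) (dW Sw 0) (dW_ne Sw 0) t) : ℂˣ) : ℂ))
    (κ₂ : C(CMAdelic (L : Type) (lineVec (L : Type) (dW Sw 0)) ⧸ CMRat (L : Type) (lineVec (L : Type) (dW Sw 0)), ℂ))
    (hκ₂ : ∀ h : CMAdelic (L : Type) (lineVec (L : Type) (dW Sw 0)),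
      κ₂ (QuotientGroup.mk h) =
        ((ĉ (UnitaryGroup.adelicInr (↥(maximalRealSubfield L)) (L : Type) (IsCMField.complexConj L) 3 1
          (Matrix.diagonal (frameD V)) (Matrix.diagonal (lineVec (L : Type) (dW Sw 0))) h) : ℂˣ) : ℂ))
    (ℓ : Module.Dual ℂ (Fin 2 → ℂ)) (Φf : FinSB (↥(maximalRealSubfield L)) (Fin 3))
    (f₂ : C(CMAdelic (L : Type) (lineVec (L : Type) (dW Sw 0)) ⧸ CMRat (L : Type) (lineVec (L : Type) (dW Sw 0)), ℂ))
    (h : (thetaKernelDatum (↥(maximalRealSubfield L)) (L : Type) (IsCMField.complexConj L) 3 1 e₁ (Matrix.diagonal (frameD V))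
          (Matrix.diagonal (lineVec (L : Type) (dW Sw 0))) (complexConj_imagUnit (L : Type)) (imagUnit_ne_zero (L : Type))
          (imagUnit_mul_self (L : Type)) (realDiagonal_isSymm (L : Type) (frameD V) (frameD_real V))
          (realDiagonal_isSymm (L : Type) (lineVec (L : Type) (dW Sw 0)) fun _ => dW_real Sw 0)
          (isUnit_det_realDiagonal (L : Type) (frameD V) (frameD_real V) (frameD_ne V))
          (isUnit_det_realDiagonal (L : Type) (lineVec (L : Type) (dW Sw 0)) (fun _ => dW_real Sw 0) fun _ => dW_ne Sw 0)
          (realDiagonal_map (L : Type) (frameD V) (frameD_real V)).symm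
          (realDiagonal_map (L : Type) (lineVec (L : Type) (dW Sw 0)) fun _ => dW_real Sw 0).symm s hs hρ SK hSK).thetaLift
        ((probHaarRelNormOneQuot (↥(maximalRealSubfield L)) (L : Type)).map
          (cosetCongr (cmLineTorusEquiv (L : Type) (dW Sw 0) (dW_ne Sw 0)) (relNormOneRat (↥(maximalRealSubfield L)) L)
            (CMRat (L : Type) (lineVec (L : Type) (dW Sw 0))) (cmLineTorusEquiv_mem_CMRat_iff (L : Type) (dW Sw 0) (dW_ne Sw 0))))
        (piSchwartzBruhatEquiv (↥(maximalRealSubfield L)) (Fin 3) (D.Φarch ℓ ⊗ₜ[ℂ] Φf)) f₂ ≠ 0) :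
    D.dist
        ((f₂ * κ₂).comp
            ⟨cosetCongr (cmLineTorusEquiv (L : Type) (dW Sw 0) (dW_ne Sw 0)) (relNormOneRat (↥(maximalRealSubfield L)) L)
                (CMRat (L : Type) (lineVec (L : Type) (dW Sw 0))) (cmLineTorusEquiv_mem_CMRat_iff (L : Type) (dW Sw 0) (dW_ne Sw 0)),
              continuous_cosetCongr _ _ _ _ (continuous_cmLineTorusEquiv (L : Type) (dW Sw 0) (dW_ne Sw 0))⟩ * κ₁)
        Φf ≠ 0 := by
  -- (3) splitting twist: the lift at `splittingOf hGR₀ = s ⊗ ĉ` of `f₂ · κ₂` is non-zero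
  have h1 := (thetaLift_mul_ne_zero_iff_of_eq_twist_aux V Sw hs ĉ hρ SK hSK _ _
    (splittingOf_isCompatible _ _ _ _ _ _ _ _ _ _ _ _ _ _ _ _ _ hGR₀) hρ₀ SK₀ hSK₀ heq κ₂ hκ₂ _ f₂).2 h
  -- (2) J-R consumption form: the model lift of `((f₂ · κ₂) ∘ a) · κ₁` is non-zero (the cocompactness instance of the model
  -- quotient is ★ `ThetaAdelicSide.compactSpace_quot`, keyed on `(V.latticeModel _).G`; we pass it explicitly)
  have h2 := (@kernelDatum_thetaLift_comp_mul_ne_zero_iff L ι₁ V Sw hGR hGR₀ hGR₁ hGR₂ hGR₃ η₀ η₁ η₂ η₃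
    ((regimeEquiv L V.Hm hV).symm.trans (cmFrameEquiv (L : Type) (frameG V) V.Hm (frameD V) (frame_congr V))).toMulEquiv
    (fun _ => rfl) (cmLineTorusEquiv (L : Type) (dW Sw 0) (dW_ne Sw 0)) (cmLineTorusEquiv_apply (L : Type) (dW Sw 0) (dW_ne Sw 0))
    (S.P 0) hSω (S.hΓU 0) (cmLineTorusEquiv_mem_CMRat_iff (L : Type) (dW Sw 0) (dW_ne Sw 0)) hρ₀ SK₀ hSK₀ _ _ _ _
    (ThetaAdelicSide.compactSpace_quot (S := S) 0)
    (probHaarRelNormOneQuot (↥(maximalRealSubfield L)) (L : Type)) _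
    (continuous_cmLineTorusEquiv (L : Type) (dW Sw 0) (dW_ne Sw 0)) (continuous_cmLineTorusEquiv_symm (L : Type) (dW Sw 0) (dW_ne Sw 0))
    κ₁ hκ₁ (piSchwartzBruhatEquiv (↥(maximalRealSubfield L)) (Fin 3) (D.Φarch ℓ ⊗ₜ[ℂ] Φf)) (f₂ * κ₂)).2 h1
  -- (1) brick 10: the distribution is non-zero
  exact dist_ne_zero_of_thetaLift_toThetaTop_ne_zero D _ Φf h2

include hSω heq hρ₀ SK₀ hSK₀ in
/-- **the `hne` row of ★ `exists_holReal_of_transport`** for the test function `f := ((f₂ · κ₂) ∘ a) · κ₁`: from ONE non-zero pin theta lift,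
`∃ Φ_f, D.dist f Φ_f ≠ 0`. [cite: Li1992, p. 178; Liu2021, proof of Prop. 4.13 (l. 2145)] -/
theorem exists_dist_ne_zero_of_pin_thetaLift_ne_zero
    (κ₁ : C(↥(relNormOneIdeles (↥(maximalRealSubfield L)) L) ⧸ relNormOneRat (↥(maximalRealSubfield L)) L, ℂ))
    (hκ₁ : ∀ t : ↥(relNormOneIdeles (↥(maximalRealSubfield L)) L),
      κ₁ (QuotientGroup.mk t) =
        ((η₀ (1, (cmAdelicOneEquivRelNormOne (L : Type)).symm t) *
            cmLineChar₀ (L : Type) finProdFinEquiv e₁ (frameD V) (frameD_real V) (frameD_ne V) (dW Sw) (dW_real Sw) (dW_ne Sw)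
              hGR hGR₀ hGR₁ (1, cmLineTorusEquiv (L : Type) (dW Sw 0) (dW_ne Sw 0) t) : ℂˣ) : ℂ))
    (κ₂ : C(CMAdelic (L : Type) (lineVec (L : Type) (dW Sw 0)) ⧸ CMRat (L : Type) (lineVec (L : Type) (dW Sw 0)), ℂ))
    (hκ₂ : ∀ h : CMAdelic (L : Type) (lineVec (L : Type) (dW Sw 0)),
      κ₂ (QuotientGroup.mk h) =
        ((ĉ (UnitaryGroup.adelicInr (↥(maximalRealSubfield L)) (L : Type) (IsCMField.complexConj L) 3 1
          (Matrix.diagonal (frameD V)) (Matrix.diagonal (lineVec (L : Type) (dW Sw 0))) h) : ℂˣ) : ℂ))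
    {ℓ : Module.Dual ℂ (Fin 2 → ℂ)} {Φf : FinSB (↥(maximalRealSubfield L)) (Fin 3)}
    (f₂ : C(CMAdelic (L : Type) (lineVec (L : Type) (dW Sw 0)) ⧸ CMRat (L : Type) (lineVec (L : Type) (dW Sw 0)), ℂ))
    (h : (thetaKernelDatum (↥(maximalRealSubfield L)) (L : Type) (IsCMField.complexConj L) 3 1 e₁ (Matrix.diagonal (frameD V))
          (Matrix.diagonal (lineVec (L : Type) (dW Sw 0))) (complexConj_imagUnit (L : Type)) (imagUnit_ne_zero (L : Type))
          (imagUnit_mul_self (L : Type)) (realDiagonal_isSymm (L : Type) (frameD V) (frameD_real V))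
          (realDiagonal_isSymm (L : Type) (lineVec (L : Type) (dW Sw 0)) fun _ => dW_real Sw 0)
          (isUnit_det_realDiagonal (L : Type) (frameD V) (frameD_real V) (frameD_ne V))
          (isUnit_det_realDiagonal (L : Type) (lineVec (L : Type) (dW Sw 0)) (fun _ => dW_real Sw 0) fun _ => dW_ne Sw 0)
          (realDiagonal_map (L : Type) (frameD V) (frameD_real V)).symm
          (realDiagonal_map (L : Type) (lineVec (L : Type) (dW Sw 0)) fun _ => dW_real Sw 0).symm s hs hρ SK hSK).thetaLift
        ((probHaarRelNormOneQuot (↥(maximalRealSubfield L)) (L : Type)).map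
          (cosetCongr (cmLineTorusEquiv (L : Type) (dW Sw 0) (dW_ne Sw 0)) (relNormOneRat (↥(maximalRealSubfield L)) L)
            (CMRat (L : Type) (lineVec (L : Type) (dW Sw 0))) (cmLineTorusEquiv_mem_CMRat_iff (L : Type) (dW Sw 0) (dW_ne Sw 0))))
        (piSchwartzBruhatEquiv (↥(maximalRealSubfield L)) (Fin 3) (D.Φarch ℓ ⊗ₜ[ℂ] Φf)) f₂ ≠ 0) :
    ∃ Φf' : FinSB (↥(maximalRealSubfield L)) (Fin 3),
      D.dist
          ((f₂ * κ₂).comp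
              ⟨cosetCongr (cmLineTorusEquiv (L : Type) (dW Sw 0) (dW_ne Sw 0)) (relNormOneRat (↥(maximalRealSubfield L)) L)
                  (CMRat (L : Type) (lineVec (L : Type) (dW Sw 0))) (cmLineTorusEquiv_mem_CMRat_iff (L : Type) (dW Sw 0) (dW_ne Sw 0)),
                continuous_cosetCongr _ _ _ _ (continuous_cmLineTorusEquiv (L : Type) (dW Sw 0) (dW_ne Sw 0))⟩ * κ₁)
          Φf' ≠ 0 :=
  ⟨Φf, dist_ne_zero_of_pin_thetaLift_ne_zero V hV Sw hGR hGR₀ hGR₁ hGR₂ hGR₃ η₀ η₁ η₂ η₃ S hSω D hρ₀ SK₀ hSK₀ hs ĉ heq hρ SK hSK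
    κ₁ hκ₁ κ₂ hκ₂ ℓ Φf f₂ h⟩

end Summit.HodgeConjecture.HodgeConjecture.Cruxes.H413.RallisTransport
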